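import Summits.RiemannHypothesis.RiemannHypothesis.Theses.LaguerreSpeiserSplit
import Literature.NumberTheory.LFunctions.RiemannXiLogDeriv

/-!
# Birth skeleton — crux `XiPrimeOnLine` (stmt-RiemannHypothesis-18896), route `LaguerreSpeiserSplit`

Crux (route decl, verbatim): `∀ z : ℂ, deriv riemannXiUpper z = 0 → z.im = 0` — every zero of
`Ξ′` is real, i.e. every zero of `ξ′(s)` lies on `Re s = 1/2` (`Ξ(z) = ξ(1/2 + iz)`,
`Ξ′(z) = ξ′(1/2 + iz)·i`).

Line (the route header's TWO-LAYER PLAN, "XiPrimeOnLine ⇐ MonotoneModulusDeriv", cut so that the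
transfer is PROVED here and the provable strip lemma is its own rung):

* `stub_zerosInStrip` — PROVABLE NOW (Levinson–Montgomery 1974 §2; Conrey 1983 Lemma 2, quoted in the
  tree docstring of `Literature.NumberTheory.LFunctions.xiDerivZeroBox`; Gauss–Lucas for `ξ`): every zero
  of `ξ′` lies in the OPEN critical strip `0 < Re s < 1`. Engine in the tree: the Hadamard partial
  fraction with multiplicities `Re ξ′/ξ(s) = Σ_ρ m(ρ)·Re 1/(s − ρ)`
  (`Literature.NumberTheory.LFunctions.hasSum_zeroOrder_mul_re_inv_sub`), each term `> 0` for `Re s ≥ 1`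
  (`ζ ≠ 0` there, Mathlib `riemannZeta_ne_zero_of_one_le_re`), so `Re ξ′/ξ > 0` and `ξ′ ≠ 0` on
  `Re s ≥ 1`; the left side by `deriv_riemannXi_one_sub`. Size M.
* `stub_horizontalMonotone` — THE HARD STUB (C⁺): for every real `t`, `σ ↦ |ξ′(σ + it)|` is strictly
  increasing on `[1/2, 1]` — horizontal monotonicity of the modulus ONE DERIVATIVE UP (for `ξ` itself this
  is the Sondow–Dumitrescu / Matiyasevich–Saidak–Zvengrowski reformulation of RH, arXiv:1205.2773 Thm 1.1,
  Lemma 2.3, Cor. 2.4–2.5, and Pólya's 1927 Nachlass criterion I′: all zeros of `F(z) = Ξ′(z)` real iff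
  `y ↦ |F(x+iy)|²` is convex). RH-implied (RH ⇒ XiPrimeOnLine ⇒ this, by the Hadamard product of the
  odd order-1 function `Ξ′`); mathematically equivalent to the crux given `stub_zerosInStrip`, but it
  EXPOSES the sign of `∂σ log|ξ′| = Re ξ″/ξ′` in the half-strip as the quantity to control. Size XL
  (open-problem strength).

Composition `XiPrimeOnLine_of` (sorry-free, below): a zero `s = 1/2 + iz` of `ξ′` with `Re s > 1/2` is
excluded by strict monotonicity from the endpoint `σ = 1/2` when `Re s ≤ 1` (`|ξ′(s)| > |ξ′(1/2+it)| ≥ 0`)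
and by the strip lemma when `Re s ≥ 1`; a zero with `Re s < 1/2` reflects to `1 − s` by
`ξ′(1 − s) = −ξ′(s)` (`Literature.NumberTheory.LFunctions.deriv_riemannXi_one_sub`); the chain rule
`Ξ′(z) = ξ′(1/2 + iz)·i` translates back to `z.im = 0`.

Shape (tree convention, cf. `Cruxes/AhfHighReal/Lines/birth.lean`): the stub statements are named
propositions `Sig.stub_*` (same short names as the registered stubs, so the skeleton audit admits them as
hypotheses); the registered stubs `stub_*` spell the signatures out verbatim (`sorry` lives ONLY there);
`XiPrimeOnLine_of (h₁ : Sig.stub_zerosInStrip) (h₂ : Sig.stub_horizontalMonotone) : XiPrimeOnLine` is the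
sorry-free composition and `XiPrimeOnLine_proof : XiPrimeOnLine` the skeleton theorem concluding the crux
BY NAME.
-/

namespace Summit.RiemannHypothesis.RiemannHypothesis.Cruxes.XiPrimeOnLine.Birth

open Summit.RiemannHypothesis.RiemannHypothesis.Theses.LaguerreSpeiserSplit (XiPrimeOnLine)
open Literature.NumberTheory.LFunctions (riemannXi riemannXiUpper differentiable_riemannXi
  deriv_riemannXi_one_sub)

/-! ## The stub statements as named propositions `Sig.stub_*` -/

namespace Sig

/-- **Stub 1 (ZEROS OF `ξ′` LIE IN THE OPEN CRITICAL STRIP; provable now).** Levinson–Montgomery 1974,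
Conrey 1983 Lemma 2: `ξ′(s) = 0 ⇒ 0 < Re s < 1`. Proof in print / in-tree engine: for `Re s ≥ 1`,
`Re ξ′/ξ(s) = Σ_ρ m(ρ)(σ − β)/|s − ρ|² > 0` (`hasSum_zeroOrder_mul_re_inv_sub`, all `β < 1`), so
`ξ′(s) ≠ 0`; `Re s ≤ 0` by `ξ′(1 − s) = −ξ′(s)`. Size M. -/
def stub_zerosInStrip : Prop :=
  ∀ s : ℂ, deriv Literature.NumberTheory.LFunctions.riemannXi s = 0 → 0 < s.re ∧ s.re < 1

/-- **Stub 2 (HORIZONTAL MONOTONICITY OF `|ξ′|` IN THE RIGHT HALF OF THE STRIP; the hard one).** For every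
real `t`, `σ ↦ |ξ′(σ + it)|` is strictly increasing on `[1/2, 1]` (Sondow–Dumitrescu / MSZ
arXiv:1205.2773 Thm 1.1 & Cor. 2.4, one derivative up; Pólya 1927 criterion I′ for `F = Ξ′`).
RH-implied; with Stub 1 it is equivalent to the crux. Size XL. -/
def stub_horizontalMonotone : Prop :=
  ∀ t : ℝ, StrictMonoOn
    (fun σ : ℝ => ‖deriv Literature.NumberTheory.LFunctions.riemannXi ((σ : ℂ) + (t : ℂ) * Complex.I)‖)
    (Set.Icc (1 / 2 : ℝ) 1)

end Sig

/-! ## The registered stubs (full signatures spelled out verbatim; `sorry` lives only here) -/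

/-- Registered stub `stub_zerosInStrip` (= `Sig.stub_zerosInStrip`, spelled out). -/
theorem stub_zerosInStrip :
    ∀ s : ℂ, deriv Literature.NumberTheory.LFunctions.riemannXi s = 0 → 0 < s.re ∧ s.re < 1 := by
  sorry

/-- Registered stub `stub_horizontalMonotone` (= `Sig.stub_horizontalMonotone`, spelled out). -/
theorem stub_horizontalMonotone :
    ∀ t : ℝ, StrictMonoOn
      (fun σ : ℝ => ‖deriv Literature.NumberTheory.LFunctions.riemannXi ((σ : ℂ) + (t : ℂ) * Complex.I)‖)
      (Set.Icc (1 / 2 : ℝ) 1) := by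
  sorry

/-! ## Composition (sorry-free) and the skeleton theorem -/

/-- Chain rule: `Ξ′(z) = ξ′(1/2 + iz) · i`. -/
theorem deriv_riemannXiUpper_eq (z : ℂ) :
    deriv riemannXiUpper z = deriv riemannXi (1 / 2 + Complex.I * z) * Complex.I := by
  have h1 : HasDerivAt (fun x : ℂ => 1 / 2 + Complex.I * x) (Complex.I * 1) z :=
    ((hasDerivAt_id z).const_mul Complex.I).const_add (1 / 2)
  have h2 : HasDerivAt riemannXi (deriv riemannXi (1 / 2 + Complex.I * z)) (1 / 2 + Complex.I * z) :=
    (differentiable_riemannXi _).hasDerivAt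
  have h3 := h2.comp z h1
  have h : riemannXiUpper = riemannXi ∘ fun x : ℂ => 1 / 2 + Complex.I * x := rfl
  rw [h, h3.deriv, mul_one]

/-- From the two stubs: a zero of `ξ′` has real part `≤ 1/2`. -/
theorem re_le_half_of_deriv_riemannXi_eq_zero (h₁ : Sig.stub_zerosInStrip)
    (h₂ : Sig.stub_horizontalMonotone) {w : ℂ} (hw : deriv riemannXi w = 0) : w.re ≤ 1 / 2 := by
  by_contra hlt
  have hlt' : 1 / 2 < w.re := lt_of_not_ge hlt
  obtain ⟨-, hw1⟩ := h₁ w hw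
  have hmem1 : (1 / 2 : ℝ) ∈ Set.Icc (1 / 2 : ℝ) 1 := ⟨le_rfl, by norm_num⟩
  have hmem2 : w.re ∈ Set.Icc (1 / 2 : ℝ) 1 := ⟨hlt'.le, hw1.le⟩
  have hsm : ‖deriv riemannXi ((((1 / 2 : ℝ)) : ℂ) + (w.im : ℂ) * Complex.I)‖
      < ‖deriv riemannXi ((w.re : ℂ) + (w.im : ℂ) * Complex.I)‖ := h₂ w.im hmem1 hmem2 hlt'
  rw [Complex.re_add_im, hw, norm_zero] at hsm
  exact absurd hsm (not_lt.2 (norm_nonneg _))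

/-- **Composition.** The two stub statements imply the crux
`Summit.RiemannHypothesis.RiemannHypothesis.Theses.LaguerreSpeiserSplit.XiPrimeOnLine` BY NAME. -/
theorem XiPrimeOnLine_of (h₁ : Sig.stub_zerosInStrip) (h₂ : Sig.stub_horizontalMonotone) :
    XiPrimeOnLine := by
  intro z hz
  rw [deriv_riemannXiUpper_eq] at hz
  have hs : deriv riemannXi (1 / 2 + Complex.I * z) = 0 := by
    rcases mul_eq_zero.mp hz with h | h
    · exact h
    · exact absurd h Complex.I_ne_zero
  have hs' : deriv riemannXi (1 - (1 / 2 + Complex.I * z)) = 0 := by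
    rw [deriv_riemannXi_one_sub, hs, neg_zero]
  have e1 := re_le_half_of_deriv_riemannXi_eq_zero h₁ h₂ hs
  have e2 := re_le_half_of_deriv_riemannXi_eq_zero h₁ h₂ hs'
  have r1 : (1 / 2 + Complex.I * z).re = 1 / 2 - z.im := by
    simp [Complex.add_re, Complex.mul_re]
    ring
  have r2 : (1 - (1 / 2 + Complex.I * z)).re = 1 / 2 + z.im := by
    simp [Complex.sub_re, Complex.add_re, Complex.mul_re]
    ring
  rw [r1] at e1
  rw [r2] at e2
  linarith

/-- **The skeleton**: the crux BY NAME from the two registered stubs (depends on `sorryAx` only through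
`stub_*`). -/
theorem XiPrimeOnLine_proof : XiPrimeOnLine :=
  XiPrimeOnLine_of stub_zerosInStrip stub_horizontalMonotone

/-! ## Calibration (sorry-free) -/

/-- The registered stubs are literally the `Sig` propositions. -/
example : (Sig.stub_zerosInStrip ↔
      (∀ s : ℂ, deriv Literature.NumberTheory.LFunctions.riemannXi s = 0 → 0 < s.re ∧ s.re < 1)) ∧
    (Sig.stub_horizontalMonotone ↔
      (∀ t : ℝ, StrictMonoOn
        (fun σ : ℝ => ‖deriv Literature.NumberTheory.LFunctions.riemannXi ((σ : ℂ) + (t : ℂ) * Complex.I)‖)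
        (Set.Icc (1 / 2 : ℝ) 1))) :=
  ⟨Iff.rfl, Iff.rfl⟩

end Summit.RiemannHypothesis.RiemannHypothesis.Cruxes.XiPrimeOnLine.Birth
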